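import Summits.BirchSwinnertonDyer.BirchSwinnertonDyer.Theorems.TeichmullerTwistDescentCarrierDefs
import Literature.RepresentationTheory.FiniteGroups.GL2MackeyBorelFunctional
import HarnessLib

/-!
# Route `TeichmullerTwistDescent`, crux K `TwistedPeriodLatticeSaturation` (stmt-BirchSwinnertonDyer-25368):
# the EXPLICIT form (I1⁗) of the automorphic input — nonvanishing of a twisted Borel (Mackey) sum of spread period
# classes of `f_D`

Cell `pub/bsd-wall` (D-0145 line route-BirchSwinnertonDyer-TeichmullerTwistDescent, OPEN rev 7), seat `bsd-line-ttd-p1`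
(prover 1/2, g25).  ONE DEFINITION (a closed `Prop`, an object the route posits, asserting nothing); no theorem, no named fact,
no instance, no notation, no `sorry`.  BSD is not proved; K is not proved; nothing here closes an item.

After `TeichmullerTwistDescentKOfBorelEigenfunctional` the K-line's inputs are (I1‴) `NonzeroBorelEigenfunctional` (a nonzero
`(B, ω̃^{p−1−b} ⊗ ω̃ᵇ)`-eigenfunctional on the carrier vanishing on `ker(spreadPeriod f_D)`) and (W‴).  The Mackey functional of
the generic `(T, B)` double coset (`Literature/…/GL2MackeyBorelFunctional`: `mackeyFunctional χ₁ χ₂ s₀ Φ =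
Σ_{t₁ t₂ a} χ₁(t₁)⁻¹χ₂(t₂)⁻¹ Φ(v(s₀) diag(t₁,t₂) u(a))`, a `(B,χ)`-eigenfunctional on `Fun(GL₂(𝔽_p), W)`) composed with the spread
period map IS such an eigenfunctional, vanishing on the kernel by construction; so (I1‴) follows from the NONVANISHING of one
value — the statement `TwistedBorelPeriodSumNonvanishing` below ((I1⁗) ⟹ (I1‴):
`KOfMackeyFunctional.nonzeroBorelEigenfunctional_of_twistedBorelPeriodSum`).
-/

set_option autoImplicit false
-- single-conjunct summit: `Summit.BirchSwinnertonDyer.BirchSwinnertonDyer.…` repeats the name by design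
set_option linter.dupNamespace false

noncomputable section

open scoped Pointwise MatrixGroups TensorProduct

open Function CongruenceSubgroup
open Literature.RepresentationTheory.FiniteGroups Literature.RepresentationTheory.FiniteGroups.GL2
  Literature.NumberTheory.EllipticCurves.ModularForms
open Literature.NumberTheory.EllipticCurves (Kato2004.teichmullerChar)
open Literature.NumberTheory.ModularSymbols Literature.NumberTheory.ModularSymbols.FullLevel
open Literature.Algebra.Homology

namespace Summit.BirchSwinnertonDyer.BirchSwinnertonDyer.Theorems.TeichmullerTwistDescent

open WeierstrassCurve Literature.NumberTheory.EllipticCurves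

/-! ### (I1⁗) the Mackey/twisted Borel period sum of `f_D` does not vanish identically -/

/-- **Twisted Borel period sum nonvanishing** (input (I1⁗) of the K-line, the EXPLICIT form of (I1‴)): for every curve `W`
of conductor `p²M` in the situation of K, with `b = tameExponent p W` (`0 < b`, `2b < p − 1`), there are `s₀ ∈ 𝔽_p`, a class
`z` of the carrier `H₁(Γ₀(M), ℤ_p[GL₂(𝔽_p)])` and a `ℤ_p`-linear coordinate `μ` on `ℤ_p ⊗ Λ_{f_D}` such that the MACKEY SUM
`Σ_{t₁,t₂ ∈ 𝔽_pˣ, a ∈ 𝔽_p} ω̃^{p−1−b}(t₁)⁻¹ ω̃ᵇ(t₂)⁻¹ · Π_{f_D}(z)(v(s₀)·diag(t₁,t₂)·u(a))` of spread values of `f_D` (torus-averaged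
`f_D`-period classes of translates of `z`) has `μ ≠ 0`.  Mathematically: the `(B, ω̃^{−b} ⊗ ω̃ᵇ)`-eigenfunctional of the generic
`(T,B)` double coset does not vanish on `Λ_Q(f_W)` ⟺ the tame principal series `Ind(ω̃^{−b} ⊗ ω̃ᵇ)` occurs in the `f_W`-part of
the full-level homology ⟺ (classically) the trace of `f_W ⊗ ω̃^{∓b}` from level `p²M` to level `pM` is nonzero (the twist has
level `pM`).  A closed `Prop`, a ROUTE-POSITED HYPOTHESIS (not a published statement; no cite tag on purpose); asserts nothing.
(I1⁗) ⟹ (I1‴) (`KOfMackeyFunctional.nonzeroBorelEigenfunctional_of_twistedBorelPeriodSum`). -/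
def TwistedBorelPeriodSumNonvanishing : Prop :=
  ∀ (p M : ℕ) [Fact p.Prime] [NeZero M] [NeZero (p ^ 2 * M)] (hpM : Nat.Coprime p M)
  [Fintype (diagTorus (ZMod p))] [Invertible (Fintype.card (diagTorus (ZMod p)) : ℤ_[p])]
  (W : WeierstrassCurve ℚ) [W.IsElliptic] [W.IsGloballyMinimal], W.conductorNorm ℤ = p ^ 2 * M →
  ∀ D : ModularParametrizationData W (p ^ 2 * M), 11 ≤ p → Rank1Residual.Addv W p → Rank1Residual.Irr W p →
  Summit.BirchSwinnertonDyer.Rank1Residual.Additive.TypeGOrd W p → padicValInt p W.minimalDiscriminantInt ≤ 4 →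
  0 < tameExponent p W ∧ 2 * tameExponent p W < p - 1 ∧
  ∃ (s₀ : ZMod p) (z : H1carrier ℤ_[p] p M)
    (μ : ℤ_[p] ⊗[ℤ] ↥(periodLattice D.f).toIntSubmodule →ₗ[ℤ_[p]] ℤ_[p]),
    μ (mackeyFunctional (Kato2004.teichmullerChar p ^ (p - 1 - tameExponent p W))
      (Kato2004.teichmullerChar p ^ tameExponent p W) s₀ (spreadPeriod ℤ_[p] p M hpM D.f z)) ≠ 0

end Summit.BirchSwinnertonDyer.BirchSwinnertonDyer.Theorems.TeichmullerTwistDescent
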